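import Literature.AlgebraicGeometry.Motives.ProjectiveNoetherNormalization
import Literature.AlgebraicGeometry.Motives.AbelianVarietyTorsionFiniteProofs
import HarnessLib

/-!
# Crux `TeissierReduction` (stmt-ResolutionOfSingularities-17085, route `TeissierJung`):
# the JUNG MODEL — a finite surjective projection of an integral closed `H ⊆ ℙᵐ_k` onto `ℙ^{dim H}_k`

Every Jung-type line of the crux starts by projecting the integral hypersurface `H ⊆ ℙᵐ_k`
finitely and surjectively onto `ℙ^d_k`, `d = dim H`. This is projective Noether normalisation,
in tree in substance as
`Literature.AlgebraicGeometry.Motives.CartierDivisor.IsAmple.exists_finite_surjective_linEquiv`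
(a finite surjective `K`-morphism `X → ℙ^{dim X}_K` for an ample Cartier divisor on an integral
proper `K`-scheme `X`, over an ARBITRARY field `K`). The glue supplied here:

* `H` is a proper `k`-scheme via `ι' ≫ (ℙᵐ → Spec k)` (closed immersions are proper);
* the class pullback of the hyperplane divisor of `ℙᵐ` along the (affine) closed immersion `ι'`
  is ample on `H` (`CartierDivisor.IsAmple.classPullback`, `ProjSpace.isAmple_hyperplane`);
* `dim H ≤ m < ∞`, so `topologicalKrullDim H = schemeDim H`
  (`topologicalKrullDim_eq_schemeDim_of_le`).

Main results:

* `exists_finite_surjective_projSpace_of_isClosedImmersion` — over ANY field `k`: an integral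
  closed subscheme `H` of `ℙᵐ_k` admits a finite surjective `k`-morphism onto `ℙ^d_k`,
  `d = dim H` (stated in the `ProjSpace.P` / `Segre.toSpec` spelling of the Motives library);
* `stub_jungModel` — the registered stub of line `Sketch` (the `projectiveSpace` spelling,
  `k` algebraically closed).
-/

-- single-problem summit: the doubled namespace component `ResolutionOfSingularities` is forced
set_option linter.dupNamespace false

noncomputable section

open CategoryTheory AlgebraicGeometry
open Literature.AlgebraicGeometry.Resolution
open Literature.AlgebraicGeometry.Motives (projectiveSpace)

universe u

namespace Summit.ResolutionOfSingularities.ResolutionOfSingularities.Theorems.TeissierReduction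

open Literature.AlgebraicGeometry.Motives Literature.AlgebraicGeometry.Motives.Segre in
/-- **Projective Noether normalisation for closed subschemes of `ℙᵐ`, over any field.** An
integral closed subscheme `H ⊆ ℙᵐ_k` admits, for `d = dim H`, a finite surjective `k`-morphism
`π₀ : H → ℙ^d_k`: the class pullback of the hyperplane divisor along the closed immersion is
ample on the proper `k`-scheme `H`, and
`CartierDivisor.IsAmple.exists_finite_surjective_linEquiv` applies (Görtz–Wedhorn I, Thm. 13.89,
there for `k` infinite; the tree version allows any field). [folklore] -/
theorem exists_finite_surjective_projSpace_of_isClosedImmersion {k : Type u} [Field k] (m : ℕ)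
    (H : Scheme.{u}) (ι : H ⟶ ProjSpace.P m k) [IsClosedImmersion ι] [IsIntegral H] :
    ∃ (d : ℕ) (π₀ : H ⟶ ProjSpace.P d k), IsFinite π₀ ∧ Function.Surjective π₀.base ∧
      π₀ ≫ toSpec (Fin (d + 1)) k = ι ≫ toSpec (Fin (m + 1)) k ∧
      topologicalKrullDim H = d := by
  -- `H` as a proper `k`-scheme through `ι`
  letI : H.Over (Spec (.of k)) := ⟨ι ≫ toSpec (Fin (m + 1)) k⟩
  haveI : IsProper (toSpec (Fin (m + 1)) k) := ProjSpace.isProper_over m k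
  haveI : IsProper (H ↘ Spec (.of k)) := inferInstanceAs (IsProper (ι ≫ toSpec (Fin (m + 1)) k))
  -- the hyperplane class restricted to `H` is ample
  have hA : ((ProjSpace.hyperplane m k).classPullback ι).IsAmple :=
    CartierDivisor.IsAmple.classPullback ι ProjSpace.isAmple_hyperplane
  obtain ⟨n₀, hn₀⟩ := hA.exists_finite_surjective_linEquiv (K := k)
  obtain ⟨-, ψ, hfin, hsurj, hψ, -⟩ := hn₀ 2 one_lt_two (n₀ + 1) (Nat.le_succ _) (Nat.succ_pos _)
  -- `dim H ≤ m` is finite, so it is `schemeDim H`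
  have hdim : topologicalKrullDim H = (schemeDim H : ℕ) :=
    topologicalKrullDim_eq_schemeDim_of_le (N := m)
      (ι.isClosedEmbedding.isInducing.topologicalKrullDim_le.trans
        (ProjSpace.topologicalKrullDim_eq m k).le)
  exact ⟨schemeDim H, ψ, hfin, ψ.surjective, hψ, hdim⟩

/-- **Finite surjective projection onto `ℙ^{dim H}` (the Jung model).** Every integral closed
subscheme `H ⊆ ℙᵐ_k` over an algebraically closed field admits, for `d = dim H`, a finite
`k`-morphism `π₀ : H → ℙ^d_k` which is surjective: the case of
`exists_finite_surjective_projSpace_of_isClosedImmersion` (valid over any field), read in the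
`projectiveSpace` spelling (`(projectiveSpace d k).left = ProjSpace.P d k` and
`(projectiveSpace d k).hom = Segre.toSpec _ k`, both by `rfl`). [folklore] -/
theorem stub_jungModel {k : Type} [Field k] [IsAlgClosed k] (m : ℕ) (H : Scheme.{0})
    (ι' : H ⟶ (projectiveSpace m k).left) [IsClosedImmersion ι'] [IsIntegral H] :
    ∃ (d : ℕ) (π₀ : H ⟶ (projectiveSpace d k).left), IsFinite π₀ ∧ Function.Surjective π₀.base ∧
      π₀ ≫ (projectiveSpace d k).hom = ι' ≫ (projectiveSpace m k).hom ∧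
      topologicalKrullDim H = d := by
  haveI : @IsClosedImmersion H (Literature.AlgebraicGeometry.Motives.ProjSpace.P m k) ι' := ‹_›
  exact exists_finite_surjective_projSpace_of_isClosedImmersion m H ι'

end Summit.ResolutionOfSingularities.ResolutionOfSingularities.Theorems.TeissierReduction

end
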